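import Summits.HodgeConjecture.CorCM.Census.CyclicCharacterQuarticLawPrep

/-!
# Cyclic characters, XIXa: THE TWO EQUATOR FACES — the kernel, and the near-zone relations of the equator faces through any cover

COR-CM (cell `pub-hodgecm2`), count-neutral kernel combinatorics by the binder seat b09 (gen 42; lane CYCLIC-CHARACTER FIBRE LAW, part XIXa), on parts XVII/XVIII
BY NAME; the first half of the ℤ/4-Sylow law (part XIX `Census/CyclicCharacterQuarticLaw.lean`).  Theorems only (no definition, no `decide` beyond numerals,
no certificate, no named fact, no `sorry`).
HONEST FRAMING: `HC_CM` is NOT proved, here or anywhere in the tree; nothing here is a period or a headline.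

* §1 the kernel of `w`: odd size when its elements have odd order (Cauchy), hence `≥ 3` with a non-trivial element; `n₀·n₀ ≠ 1`.
* §2 **THE EQUATOR RELATIONS**: with `n = |ker w| = 2m + 1`, the three-across face `gface X_{B'} t t'` (`|B'| = m`) and the one-across face
  `gface X_{B'∖b} b t` in a lattice `L` with the toward property of any cover yield `R(B') ∈ L` and `R(B' ∪ t) ∈ L`, where
  `R(X) = [T_0] − [T_1] + Σ_{s ∈ X} ε_s − Σ_{s ∈ F_0∖X} η_s` (`rel_of_threeAcross`, `rel_of_oneAcross`; via part XVII).
-/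

namespace Summit.HodgeConjecture.CorCM.Census.CyclicCharacter

open Finset
open Summit.HodgeConjecture.CorCM.Prior.AllgGroup.RfwfAllgGroup
open Summit.HodgeConjecture.CorCM.Census.BlockParity
open Summit.HodgeConjecture.CorCM.Census.Coinvariant
open Summit.HodgeConjecture.CorCM.Census.TwistGeneration
open Summit.HodgeConjecture.CorCM.Census.Nondegenerate
open Summit.HodgeConjecture.CorCM.Census.BaseBlock

noncomputable section

variable {G : Type*} [Group G] [Fintype G] [DecidableEq G] {k : ℕ} {w : G → ZMod (2 ^ k)} {c : G}

/-! ## §1 The kernel: odd, of size at least three -/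

omit [DecidableEq G] in
/-- **A kernel of odd-order elements has odd size** (Cauchy). [folklore] -/
theorem odd_card_ker (hw : ∀ P Q : G, w (P * Q) = w P + w Q) (hodd : ∀ g : G, w g = 0 → Odd (orderOf g)) :
    Odd (univ.filter fun s : G => w s = 0).card := by
  let K : Subgroup G :=
    { carrier := {g | w g = 0}
      mul_mem' := fun {a b} ha hb => by show w (a * b) = 0; rw [hw, ha, hb, add_zero]
      one_mem' := map_one hw
      inv_mem' := fun {a} ha => by show w a⁻¹ = 0; rw [map_inv hw, ha, neg_zero] }
  haveI : DecidablePred (· ∈ K) := fun g => decidable_of_iff (w g = 0) Iff.rfl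
  have hK : Fintype.card K = (univ.filter fun s : G => w s = 0).card := by
    rw [Fintype.card_subtype]
    exact congrArg Finset.card (filter_congr fun g _ => Iff.rfl)
  by_contra h
  rw [Nat.not_odd_iff_even, even_iff_two_dvd, ← hK] at h
  haveI : Fact (Nat.Prime 2) := ⟨Nat.prime_two⟩
  obtain ⟨x, hx⟩ := exists_prime_orderOf_dvd_card 2 h
  have h2 := hodd (x : G) x.2
  rw [Subgroup.orderOf_coe, hx] at h2
  exact (Nat.not_odd_iff_even.mpr (by decide)) h2

/-- With a non-trivial kernel element, **the kernel has at least `3` elements** (odd and `≥ 2`). [folklore] -/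
theorem three_le_card_ker (hw : ∀ P Q : G, w (P * Q) = w P + w Q) (hodd : ∀ g : G, w g = 0 → Odd (orderOf g)) {n₀ : G} (hn₀ : w n₀ = 0)
    (hn₀1 : n₀ ≠ 1) : 3 ≤ (univ.filter fun s : G => w s = 0).card := by
  have h2 : 2 ≤ (univ.filter fun s : G => w s = 0).card := by
    calc 2 = ({1, n₀} : Finset G).card := by rw [card_pair hn₀1.symm]
      _ ≤ _ := card_le_card fun x hx => by
          rw [mem_insert, mem_singleton] at hx
          rw [mem_filter]
          rcases hx with rfl | rfl
          · exact ⟨mem_univ _, map_one hw⟩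
          · exact ⟨mem_univ _, hn₀⟩
  obtain ⟨m, hm⟩ := odd_card_ker hw hodd
  omega

omit [Fintype G] [DecidableEq G] in
/-- An odd-order element `≠ 1` has `n₀ · n₀ ≠ 1`. [folklore] -/
theorem mul_self_ne_one_of_odd {n₀ : G} (hodd : Odd (orderOf n₀)) (hn₀1 : n₀ ≠ 1) : n₀ * n₀ ≠ 1 := by
  intro h
  have h2 : orderOf n₀ ∣ 2 := orderOf_dvd_of_pow_eq_one (by rw [pow_two, h])
  have h1 : orderOf n₀ = 1 := by
    rcases (Nat.dvd_prime Nat.prime_two).mp h2 with h1 | h1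
    · exact h1
    · exfalso; rw [h1] at hodd; exact (Nat.not_odd_iff_even.mpr (by decide)) hodd
  exact hn₀1 (orderOf_eq_one_iff.mp h1)

/-! ## §2 The two equator faces and their near-zone relations -/

/-- Flipping an unflipped bottom point adds it to the `T_0`-deviation. [folklore] -/
theorem sdiff_oflipCM_eq_insert (hw : ∀ P Q : G, w (P * Q) = w P + w Q) (hk : 1 ≤ k) (hc2 : c * c = 1) (hwc : w c ≠ 0) {X : CMF G c}
    {B : Finset G} (hX : (arcType hw hk hc2 hwc 0).1 \ X.1 = B) {t : G} (ht : w t = 0) (htB : t ∉ B) :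
    (arcType hw hk hc2 hwc 0).1 \ (oflipCM c hc2 t X).1 = insert t B := by
  have htT : t ∈ (arcType hw hk hc2 hwc 0).1 := (mem_arcType_zero_and_notMem_one hw hk hc2 hwc ht).1
  have htX : t ∈ X.1 := by
    by_contra h
    exact htB (hX ▸ mem_sdiff.mpr ⟨htT, h⟩)
  rw [dev_oflip_of_mem c hc2 htT htX, hX]

/-- **The distance of a bottom-deviating type to `T_1`**, subtraction form. [folklore] -/
theorem ddist_arcType_one_eq (hw : ∀ P Q : G, w (P * Q) = w P + w Q) (hk : 1 ≤ k) (hc2 : c * c = 1) (hwc : w c ≠ 0) {X : CMF G c}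
    {B : Finset G} (hX : (arcType hw hk hc2 hwc 0).1 \ X.1 = B) (hB : B ⊆ univ.filter fun s => w s = 0) :
    ddist (arcType hw hk hc2 hwc 1) X = (univ.filter fun s : G => w s = 0).card - B.card := by
  have h := ddist_arcType_one_add hw hk hc2 hwc X (hX ▸ hB)
  rw [hX] at h
  omega

/-- **THE THREE-ACROSS EQUATOR RELATION.**  If `L` has the toward property, `T_0 ∖ X = B' ⊆ F_0` with `2|B'| < |F_0|` and `2(|F_0| − |B'| − 1) < |F_0|`,
`t ≠ t' ∈ F_0 ∖ B'`, and the face `gface X t t'` lies in `L`, then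
`R(B') = [T_0] − [T_1] + Σ_{s ∈ B'} ε_s − Σ_{s ∈ F_0∖B'} η_s ∈ L`. [folklore] -/
theorem rel_of_threeAcross (hw : ∀ P Q : G, w (P * Q) = w P + w Q) (hk : 1 ≤ k) (hc2 : c * c = 1) (hwc : w c ≠ 0)
    (h1 : ∃ g₁ : G, w g₁ = 1) (L : Submodule ℤ (CMF G c →₀ ℤ))
    (htw : ∀ Φ : CMF G c, 2 ≤ bpot c (arcType hw hk hc2 hwc 0) Φ → ∃ Q t t' : G,
      bpot c (arcType hw hk hc2 hwc 0) Φ = ddist (rt c Q (arcType hw hk hc2 hwc 0)) Φ ∧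
        t ∈ (rt c Q (arcType hw hk hc2 hwc 0)).1 \ Φ.1 ∧ t' ∈ (rt c Q (arcType hw hk hc2 hwc 0)).1 \ Φ.1 ∧ t ≠ t' ∧ gface c hc2 Φ t t' ∈ L)
    {X : CMF G c} {B' : Finset G} (hX : (arcType hw hk hc2 hwc 0).1 \ X.1 = B') (hB' : B' ⊆ univ.filter fun s => w s = 0)
    (hsmall : 2 * B'.card < (univ.filter fun s : G => w s = 0).card)
    (hlarge : 2 * ((univ.filter fun s : G => w s = 0).card - B'.card - 1) < (univ.filter fun s : G => w s = 0).card)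
    {t t' : G} (ht : w t = 0) (ht' : w t' = 0) (htB : t ∉ B') (ht'B : t' ∉ B') (htt' : t ≠ t') (hf : gface c hc2 X t t' ∈ L) :
    Finsupp.single (arcType hw hk hc2 hwc 0) (1 : ℤ) - Finsupp.single (arcType hw hk hc2 hwc 1) 1 +
      (∑ s ∈ B', (Finsupp.single (oflipCM c hc2 s (arcType hw hk hc2 hwc 0)) (1 : ℤ) - Finsupp.single (arcType hw hk hc2 hwc 0) 1)) -
      (∑ s ∈ (univ.filter fun s => w s = 0) \ B',
        (Finsupp.single (oflipCM c hc2 s (arcType hw hk hc2 hwc 1)) (1 : ℤ) - Finsupp.single (arcType hw hk hc2 hwc 1) 1)) ∈ L := by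
  obtain ⟨Qm, hQm⟩ := exists_apply_eq hw h1 (-1)
  have eT₁ : arcType hw hk hc2 hwc 1 = rt c Qm (arcType hw hk hc2 hwc 0) := arcType_eq_rt hw hk hc2 hwc hQm
  have htF : t ∈ univ.filter (fun s : G => w s = 0) := mem_filter.mpr ⟨mem_univ _, ht⟩
  have ht'F : t' ∈ univ.filter (fun s : G => w s = 0) := mem_filter.mpr ⟨mem_univ _, ht'⟩
  -- deviation sets of the four corners
  have hXt : (arcType hw hk hc2 hwc 0).1 \ (oflipCM c hc2 t X).1 = insert t B' := sdiff_oflipCM_eq_insert hw hk hc2 hwc hX ht htB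
  have hXt' : (arcType hw hk hc2 hwc 0).1 \ (oflipCM c hc2 t' X).1 = insert t' B' := sdiff_oflipCM_eq_insert hw hk hc2 hwc hX ht' ht'B
  have hXtt' : (arcType hw hk hc2 hwc 0).1 \ (oflipCM c hc2 t (oflipCM c hc2 t' X)).1 = insert t (insert t' B') :=
    sdiff_oflipCM_eq_insert hw hk hc2 hwc hXt' ht (by rw [mem_insert]; push Not; exact ⟨htt', htB⟩)
  have hBt : insert t B' ⊆ univ.filter fun s : G => w s = 0 := insert_subset htF hB'
  have hBt' : insert t' B' ⊆ univ.filter fun s : G => w s = 0 := insert_subset ht'F hB'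
  have hBtt' : insert t (insert t' B') ⊆ univ.filter fun s : G => w s = 0 := insert_subset htF hBt'
  have hct : (insert t B').card = B'.card + 1 := card_insert_of_notMem htB
  have hct' : (insert t' B').card = B'.card + 1 := card_insert_of_notMem ht'B
  have hctt' : (insert t (insert t' B')).card = B'.card + 2 := by
    rw [card_insert_of_notMem (by rw [mem_insert]; push Not; exact ⟨htt', htB⟩), hct']
  -- the four distance conditions
  have h₁ : 2 * ddist (rt c 1 (arcType hw hk hc2 hwc 0)) X < (univ.filter fun s : G => w s = 0).card := by
    rw [rt_one]; unfold ddist; rw [hX]; exact hsmall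
  have h₂ : 2 * ddist (rt c Qm (arcType hw hk hc2 hwc 0)) (oflipCM c hc2 t (oflipCM c hc2 t' X)) < (univ.filter fun s : G => w s = 0).card := by
    rw [← eT₁, ddist_arcType_one_eq hw hk hc2 hwc hXtt' hBtt', hctt']; omega
  have h₃ : 2 * ddist (rt c Qm (arcType hw hk hc2 hwc 0)) (oflipCM c hc2 t X) < (univ.filter fun s : G => w s = 0).card := by
    rw [← eT₁, ddist_arcType_one_eq hw hk hc2 hwc hXt hBt, hct]; omega
  have h₄ : 2 * ddist (rt c Qm (arcType hw hk hc2 hwc 0)) (oflipCM c hc2 t' X) < (univ.filter fun s : G => w s = 0).card := by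
    rw [← eT₁, ddist_arcType_one_eq hw hk hc2 hwc hXt' hBt', hct']; omega
  have hrel := alt_normalForm_mem_of_gface_mem hw hk hc2 hwc L htw hf 1 Qm Qm Qm h₁ h₂ h₃ h₄
  rw [rt_one, ← eT₁, hX, normalForm_one_eq hw hk hc2 hwc _ (hXtt'.symm ▸ hBtt'), normalForm_one_eq hw hk hc2 hwc _ (hXt.symm ▸ hBt),
    normalForm_one_eq hw hk hc2 hwc _ (hXt'.symm ▸ hBt'), hXtt', hXt, hXt'] at hrel
  -- bookkeeping over `U = F_0 ∖ B'`
  have hU : t ∈ (univ.filter fun s : G => w s = 0) \ B' := mem_sdiff.mpr ⟨htF, htB⟩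
  have hU' : t' ∈ (univ.filter fun s : G => w s = 0) \ B' := mem_sdiff.mpr ⟨ht'F, ht'B⟩
  simp only [sdiff_insert] at hrel
  set H : G → (CMF G c →₀ ℤ) := fun s =>
    Finsupp.single (oflipCM c hc2 s (arcType hw hk hc2 hwc 1)) (1 : ℤ) - Finsupp.single (arcType hw hk hc2 hwc 1) 1 with hH
  set U := (univ.filter fun s : G => w s = 0) \ B' with hUdef
  have e1 : (∑ s ∈ U.erase t, H s) = H t' + ∑ s ∈ (U.erase t').erase t, H s := by
    rw [← add_sum_erase _ _ (mem_erase.mpr ⟨htt'.symm, hU'⟩), erase_right_comm]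
  have e2 : (∑ s ∈ U.erase t', H s) = H t + ∑ s ∈ (U.erase t').erase t, H s := by
    rw [← add_sum_erase _ _ (mem_erase.mpr ⟨htt', hU⟩)]
  have e3 : (∑ s ∈ U, H s) = H t + (H t' + ∑ s ∈ (U.erase t').erase t, H s) := by
    rw [← add_sum_erase _ _ hU, e1]
  rw [e1, e2] at hrel
  rw [e3]
  convert hrel using 1
  abel

/-- **THE ONE-ACROSS EQUATOR RELATION.**  If `L` has the toward property, `T_0 ∖ X = B' ∖ b` (`b ∈ B' ⊆ F_0`) with `2|B'| < |F_0|` and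
`2(|F_0| − |B'| − 1) < |F_0|`, `t ∈ F_0 ∖ B'`, and the face `gface X b t` lies in `L`, then `R(B' ∪ t) ∈ L`, i.e.
`[T_0] − [T_1] + Σ_{s ∈ B'} ε_s + ε_t − Σ_{s ∈ F_0∖B'∖t} η_s ∈ L`. [folklore] -/
theorem rel_of_oneAcross (hw : ∀ P Q : G, w (P * Q) = w P + w Q) (hk : 1 ≤ k) (hc2 : c * c = 1) (hwc : w c ≠ 0)
    (h1 : ∃ g₁ : G, w g₁ = 1) (L : Submodule ℤ (CMF G c →₀ ℤ))
    (htw : ∀ Φ : CMF G c, 2 ≤ bpot c (arcType hw hk hc2 hwc 0) Φ → ∃ Q t t' : G,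
      bpot c (arcType hw hk hc2 hwc 0) Φ = ddist (rt c Q (arcType hw hk hc2 hwc 0)) Φ ∧
        t ∈ (rt c Q (arcType hw hk hc2 hwc 0)).1 \ Φ.1 ∧ t' ∈ (rt c Q (arcType hw hk hc2 hwc 0)).1 \ Φ.1 ∧ t ≠ t' ∧ gface c hc2 Φ t t' ∈ L)
    {X : CMF G c} {B' : Finset G} {b : G} (hb : b ∈ B') (hX : (arcType hw hk hc2 hwc 0).1 \ X.1 = B'.erase b)
    (hB' : B' ⊆ univ.filter fun s => w s = 0)
    (hsmall : 2 * B'.card < (univ.filter fun s : G => w s = 0).card)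
    (hlarge : 2 * ((univ.filter fun s : G => w s = 0).card - B'.card - 1) < (univ.filter fun s : G => w s = 0).card)
    {t : G} (ht : w t = 0) (htB : t ∉ B') (hf : gface c hc2 X b t ∈ L) :
    Finsupp.single (arcType hw hk hc2 hwc 0) (1 : ℤ) - Finsupp.single (arcType hw hk hc2 hwc 1) 1 +
      (∑ s ∈ B', (Finsupp.single (oflipCM c hc2 s (arcType hw hk hc2 hwc 0)) (1 : ℤ) - Finsupp.single (arcType hw hk hc2 hwc 0) 1)) +
      (Finsupp.single (oflipCM c hc2 t (arcType hw hk hc2 hwc 0)) (1 : ℤ) - Finsupp.single (arcType hw hk hc2 hwc 0) 1) -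
      (∑ s ∈ ((univ.filter fun s => w s = 0) \ B').erase t,
        (Finsupp.single (oflipCM c hc2 s (arcType hw hk hc2 hwc 1)) (1 : ℤ) - Finsupp.single (arcType hw hk hc2 hwc 1) 1)) ∈ L := by
  obtain ⟨Qm, hQm⟩ := exists_apply_eq hw h1 (-1)
  have eT₁ : arcType hw hk hc2 hwc 1 = rt c Qm (arcType hw hk hc2 hwc 0) := arcType_eq_rt hw hk hc2 hwc hQm
  have hb0 : w b = 0 := (mem_filter.mp (hB' hb)).2
  have htF : t ∈ univ.filter (fun s : G => w s = 0) := mem_filter.mpr ⟨mem_univ _, ht⟩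
  have hbt : b ≠ t := fun h => htB (h ▸ hb)
  -- deviation sets of the four corners
  have hXb : (arcType hw hk hc2 hwc 0).1 \ (oflipCM c hc2 b X).1 = B' := by
    rw [sdiff_oflipCM_eq_insert hw hk hc2 hwc hX hb0 (notMem_erase b B'), insert_erase hb]
  have hXt : (arcType hw hk hc2 hwc 0).1 \ (oflipCM c hc2 t X).1 = insert t (B'.erase b) :=
    sdiff_oflipCM_eq_insert hw hk hc2 hwc hX ht (fun h => htB (mem_of_mem_erase h))
  have hXbt : (arcType hw hk hc2 hwc 0).1 \ (oflipCM c hc2 b (oflipCM c hc2 t X)).1 = insert t B' := by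
    rw [sdiff_oflipCM_eq_insert hw hk hc2 hwc hXt hb0 (by rw [mem_insert]; push Not; exact ⟨hbt, notMem_erase b B'⟩),
      Finset.insert_comm, insert_erase hb]
  have hBe : B'.erase b ⊆ univ.filter fun s : G => w s = 0 := (erase_subset b B').trans hB'
  have hBt : insert t B' ⊆ univ.filter fun s : G => w s = 0 := insert_subset htF hB'
  have hBte : insert t (B'.erase b) ⊆ univ.filter fun s : G => w s = 0 := insert_subset htF hBe
  have hce : (B'.erase b).card + 1 = B'.card := card_erase_add_one hb
  have hct : (insert t B').card = B'.card + 1 := card_insert_of_notMem htB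
  have hcte : (insert t (B'.erase b)).card = (B'.erase b).card + 1 := card_insert_of_notMem fun h => htB (mem_of_mem_erase h)
  -- distances: three corners near `T_0`, the corner `X^{(b)(t)}` near `T_1`
  have h₁ : 2 * ddist (rt c 1 (arcType hw hk hc2 hwc 0)) X < (univ.filter fun s : G => w s = 0).card := by
    rw [rt_one]; unfold ddist; rw [hX]; omega
  have h₂ : 2 * ddist (rt c Qm (arcType hw hk hc2 hwc 0)) (oflipCM c hc2 b (oflipCM c hc2 t X)) < (univ.filter fun s : G => w s = 0).card := by
    rw [← eT₁, ddist_arcType_one_eq hw hk hc2 hwc hXbt hBt, hct]; omega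
  have h₃ : 2 * ddist (rt c 1 (arcType hw hk hc2 hwc 0)) (oflipCM c hc2 b X) < (univ.filter fun s : G => w s = 0).card := by
    rw [rt_one]; unfold ddist; rw [hXb]; exact hsmall
  have h₄ : 2 * ddist (rt c 1 (arcType hw hk hc2 hwc 0)) (oflipCM c hc2 t X) < (univ.filter fun s : G => w s = 0).card := by
    rw [rt_one]; unfold ddist; rw [hXt, hcte]; omega
  have hrel := alt_normalForm_mem_of_gface_mem hw hk hc2 hwc L htw hf 1 Qm 1 1 h₁ h₂ h₃ h₄
  rw [rt_one, ← eT₁, hX, hXb, hXt, normalForm_one_eq hw hk hc2 hwc _ (hXbt.symm ▸ hBt), hXbt, sdiff_insert,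
    sum_insert (fun h => htB (mem_of_mem_erase h))] at hrel
  set E : G → (CMF G c →₀ ℤ) := fun s =>
    Finsupp.single (oflipCM c hc2 s (arcType hw hk hc2 hwc 0)) (1 : ℤ) - Finsupp.single (arcType hw hk hc2 hwc 0) 1 with hE
  have e1 : (∑ s ∈ B', E s) = E b + ∑ s ∈ B'.erase b, E s := (add_sum_erase B' E hb).symm
  rw [e1] at hrel ⊢
  rw [← Submodule.neg_mem_iff]
  convert hrel using 1
  abel


end

end Summit.HodgeConjecture.CorCM.Census.CyclicCharacter
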